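import Summits.HodgeConjecture.HodgeConjecture.Theorems.R90S7QsSelfSimilitudeInner                 -- ★ part 1∕3: `comap_eq_comap_of_conj_formCongr_qsForm`, `formCongr_inv_eq_smul_of_formCongr_eq_smul`
import Summits.HodgeConjecture.HodgeConjecture.Theorems.F0P3XiPacketFamilyOfRecordSCD             -- ★ the record `xiPacketFamilyOfRecordSCD` (+ `_of_split`, `_of_nonsplit`, `splitWitness`)
import Summits.HodgeConjecture.HodgeConjecture.Theorems.R90S9SimilCongrLocalConstituents            -- ★ S9: `cmSplitPacket_map_comap_cmDatumLocalCongr_symm`, `IrrClass.comap_comap`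
import Summits.HodgeConjecture.HodgeConjecture.Theorems.R90S9SignedClauseCongrTransport             -- ★ S9: `charIdentityAtTestSigned_pair_transport_formCongr`, `clauseSign_antidiag_frame_eq_one` (+ ★ `clauseSign_eq_intCast_formSignAt`)
import HarnessLib

/-!
# R90-TF · S7 (Ch. 14.6-tuple, C146) · S7-J2★ «O2 JUNCTION», PART 3∕3 — the H-side record AND its signed supercuspidal datum ride the kit's `ψ_v` to `U(Φ₃)`
# ([Rogawski1990, §14.1–14.2 pp. 232–234 «fix an inner isomorphism ψ … the equivalence classes of representations are canonically identified»; §13.1 Prop. 13.1.4 p. 199; §14.6 p. 242])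

Cell `hodgecm-mathlib`, crux H413 (`stmt-HodgeConjecture-24833`), route of record `HCCMUnconditional`; programme R90-TF (brief `director/R90-BRIEF.v2.md`
1f40d54518340a35), section S7 = Rogawski §14.6 (base `R90-C146`), seat R90-C146-p01 (g0); deal S7-R8∕S7-J2★ (LH7-plan (g4)) under RULINGS S7-R9 (B), S7-R11 (b),
S7-R12 (no ψ-hypothesis), S7-R14 (F2: datum `hSC` + pin `hSCid` of ★ `R90.S7.QsRigidCore`, p862183).  Helper file 3∕3 of the junction
`Theorems/R90S7RigidCoreOfQsRigidity.lean` (`pkRigidCore_of_qsRigidCore : (∀ L, QsRigidCore L) → F0U3LettersRung1.PKrigidCoreLetter`, typed against leaf ED. 6 = O2′),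
lane `--supports stmt-HodgeConjecture-24833 --as helper`; LEAF-FREE, KIT-FREE; theorems only (no `def`, no instance, no notation, no `sorry`).

CONTENT.
* §3 THE TRANSPORTED H-RECORD IS THE INTRINSIC Φ₃-RECORD (`exists_transportAPackets_xiPacketFamilyOfRecordSCD_eq`): if every `ψ_v : U(H)_v ≃ₜ* U(Φ₃)_v` is a form
  congruence `Ad(T₂)`, there is a supercuspidal-partner datum `hSC₀` on `U(Φ₃)` — the H-datum `hSC` read through `ψ_v` at the H-record's own frame (second clause: its
  SHAPE) — with `(Rec_H ξ v).map (comap ψ_v⁻¹) = Rec_{Φ₃} ξ v` at EVERY finite `v` (= ★ `transportAPackets ψ Rec_H ξ v`; split: ★ S9 `cmSplitPacket_map_comap_cmDatumLocalCongr_symm`,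
  non-split: part 1, a self-similitude is inner).
* §4 THE SIGNED [13.1.4] ON TEST FUNCTIONS RIDES WITH IT (`charIdentityAtTest_transport_of_frames`): if `⟨πⁿ ∘ e_{T₁}⁻¹, πˢ⟩` satisfies the signed identity on `U(H)_v`
  with the clause sign `χ(a₁)` at `(Δ‴_H, m_H, m_G, ν_G, ν_H, ξ_v)`, then for EVERY Φ₃-self-frame `(T″, a″)` the packet `⟨πⁿ ∘ e_{T″}⁻¹, πˢ ∘ e_S⟩` satisfies it on `U(Φ₃)_v`
  with the clause sign `χ(a″)` at `(Δ‴_{Φ₃}, m_H, e_S⁻¹_* m_G, e_S⁻¹_* ν_G, ν_H, ξ_v)` (★ S9 `charIdentityAtTestSigned_pair_transport_formCongr` along the H-frame `(S, m)` + part 1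
  + the sign law `χ(m) = χ(a₁) = ε_v(H)` ★ `clauseSign_eq_intCast_formSignAt`, `ε_v(H)² = 1`, `χ(a″) = 1` ★ `clauseSign_antidiag_frame_eq_one`) — exactly the `hSCid`
  binder of ★ `R90.S7.QsRigidCore` for the transported datum.

HONEST LABEL: transport lemmas close no citation.  HC_CM is proved only modulo the 7 printed citations (2 remaining named inputs: hLiu418 = stmt-HodgeConjecture-24832,
h413 = stmt-HodgeConjecture-24833) — until rung 0 closes.

## References
* [Rogawski1990] J. D. Rogawski, *Automorphic Representations of Unitary Groups in Three Variables*, Ann. of Math. Stud. 123 (1990): §12.2 (2) pp. 173–174;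
  §13.1 Prop. 13.1.3 (d), Prop. 13.1.4 p. 199; §14.1–§14.2 pp. 232–234; §14.6 p. 242.
* [BushnellHenniart2006] C. J. Bushnell, G. Henniart, *The Local Langlands Conjecture for GL(2)*, Grundlehren 335 (2006), §1.1.
* [LanglandsShelstad1987] R. P. Langlands, D. Shelstad, *On the definition of transfer factors*, Math. Ann. 278 (1987), §1, §4.2.
-/

set_option autoImplicit false
-- the mandated namespace repeats the single-problem summit's segment (`HodgeConjecture.HodgeConjecture`)
set_option linter.dupNamespace false

noncomputable section

open NumberField IsDedekindDomain MeasureTheory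
open scoped Matrix MatrixGroups

namespace Summit.HodgeConjecture.HodgeConjecture.R90.S7

open Literature.NumberTheory Literature.NumberTheory.Automorphic Literature.NumberTheory.Automorphic.UnitaryGroup
open Literature.NumberTheory.Rogawski1990 Literature.NumberTheory.GaloisRepresentations
open Summit.HodgeConjecture.HodgeConjecture.Cruxes.H413
open Summit.HodgeConjecture.HodgeConjecture.Cruxes.H413.F0P3XiPacketFamilyOfRecordSCD (xiPacketFamilyOfRecordSCD)
/-! ## §3 The transported H-record IS the intrinsic `Φ₃`-record (with the transported supercuspidal datum) -/

section Transport

variable (L : Type) [Field L] [NumberField L] [IsCMField L] (H : Matrix (Fin 3) (Fin 3) L)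
  (hH : (H.map (cmConjRingHom L))ᵀ = H) (hHd : IsUnit H.det)
  (hq : ((qsForm L).map (cmConjRingHom L))ᵀ = qsForm L) (hqd : IsUnit (qsForm L).det)
  (μω : HeckeCharacter L) (hμu : μω.IsUnitary)
  [∀ v : HeightOneSpectrum (𝓞 ↥(maximalRealSubfield L)), MeasurableSpace (Gqs L v ⧸ Subgroup.center (Gqs L v))]
  (μZ : ∀ v : HeightOneSpectrum (𝓞 ↥(maximalRealSubfield L)), Measure (Gqs L v ⧸ Subgroup.center (Gqs L v)))
  (keys : ∀ (ξ : OneDimAutRepH L) (v : HeightOneSpectrum (𝓞 ↥(maximalRealSubfield L))),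
    (∀ w : PlacesOver L v, IsCMField.complexConj L • w.1 = w.1) →
      {p : IrrClass (Gqs L v) × IrrClass (Gqs L v) //
        KeysCaseTwoLabels L v (μω.semilocalComponent L v) (torusLocalComponent L (IsCMField.complexConj L) v ξ.η)
          (torusLocalComponent L (IsCMField.complexConj L) v ξ.ψ) p.1 p.2 ∧
        p.1.IsSquareIntegrable (μZ v) ∧ ¬ p.2.IsSquareIntegrable (μZ v)})
  (hSC : ∀ (ξ : OneDimAutRepH L) (v : HeightOneSpectrum (𝓞 ↥(maximalRealSubfield L)))
    (hns : ∀ w : PlacesOver L v, IsCMField.complexConj L • w.1 = w.1)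
    (T : GL (Fin 3) (LocalRing L v)) (a : LocalRing L v) (ha : IsUnit a)
    (h : formCongr (conjLocal L (IsCMField.complexConj L) v) T (H.map (algebraMap L (LocalRing L v))) =
      a • (Matrix.of fun i j : Fin 3 => if i.val + j.val + 1 = 3 then (1 : L) else 0).map (algebraMap L (LocalRing L v)))
    (π2 πn : IrrClass (Gqs L v)),
    KeysCaseTwoLabels L v (μω.semilocalComponent L v) (torusLocalComponent L (IsCMField.complexConj L) v ξ.η)
      (torusLocalComponent L (IsCMField.complexConj L) v ξ.ψ) π2 πn → ¬ πn.IsSquareIntegrable (μZ v) →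
    {πs : IrrClass ((cmDatum L 3 H).Local v) // πs.IsSupercuspidal ∧ πs ≠ IrrClass.comap (cmDatumLocalCongr L v T ha h).symm πn})
  (ψ : ∀ v : HeightOneSpectrum (𝓞 ↥(maximalRealSubfield L)), (cmDatum L 3 H).Local v ≃ₜ* (cmDatum L 3 (qsForm L)).Local v)
  (hψ : ∀ v : HeightOneSpectrum (𝓞 ↥(maximalRealSubfield L)),
    ∃ (T : GL (Fin 3) (LocalRing L v)) (a : LocalRing L v) (ha : IsUnit a)
      (h : formCongr (conjLocal L (IsCMField.complexConj L) v) T ((qsForm L).map (algebraMap L (LocalRing L v))) =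
        a • H.map (algebraMap L (LocalRing L v))),
      ∀ g, ψ v g = cmDatumLocalCongr L v T ha h g)

include hψ in
set_option maxHeartbeats 2000000 in
/-- **THE TRANSPORTED H-RECORD IS THE INTRINSIC Φ₃-RECORD.**  If every `ψ_v` is a form congruence `Ad(T₂)` (`ᵗT̄₂ Φ₃ T₂ = a₂ H`), there is a supercuspidal-partner datum
`hSC₀` on `U(Φ₃)` — the H-datum read through `ψ_v` at the H-record's own frame `T₁` (second clause: its SHAPE) — such that at EVERY finite `v` and for every `ξ` the H-side
record ★ `xiPacketFamilyOfRecordSCD L H …` transported along `ψ_v` (`.map (comap ψ_v⁻¹)`, = ★ `transportAPackets`) EQUALS the Φ₃-side record ★ `xiPacketFamilyOfRecordSCD L (qsForm L)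
… hSC₀` (first clause).  Split `v`: both are the split packet at the fixed witness, and the split packet rides the congruence (★ S9 `cmSplitPacket_map_comap_cmDatumLocalCongr_symm`).
Non-split `v`: the H-record is `⟨πⁿ_keys ∘ Ad(T₁)⁻¹, πˢ_H⟩`, the Φ₃-record is `⟨πⁿ_keys ∘ Ad(T₀)⁻¹, πˢ₀⟩` for congruences `T₁ : Φ₃ ⇝ H`, `T₀ : Φ₃ ⇝ Φ₃`; `Ad(T₂T₁)⁻¹` and `Ad(T₀)⁻¹`
differ by the self-similitude `(T₂T₁)⁻¹T₀`, which is inner (`comap_eq_comap_of_conj_formCongr_qsForm`), and `πˢ₀ := πˢ_H ∘ ψ_v⁻¹` by construction.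
[cite: Rogawski1990, §14.2 pp. 232–234; §13.1 p. 199; §12.2 (2) pp. 173–174] [cite: BushnellHenniart2006, §1.1] -/
theorem exists_transportAPackets_xiPacketFamilyOfRecordSCD_eq :
    ∃ hSC₀ : ∀ (ξ : OneDimAutRepH L) (v : HeightOneSpectrum (𝓞 ↥(maximalRealSubfield L)))
        (hns : ∀ w : PlacesOver L v, IsCMField.complexConj L • w.1 = w.1)
        (T : GL (Fin 3) (LocalRing L v)) (a : LocalRing L v) (ha : IsUnit a)
        (h : formCongr (conjLocal L (IsCMField.complexConj L) v) T ((qsForm L).map (algebraMap L (LocalRing L v))) =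
          a • (Matrix.of fun i j : Fin 3 => if i.val + j.val + 1 = 3 then (1 : L) else 0).map (algebraMap L (LocalRing L v)))
        (π2 πn : IrrClass (Gqs L v)),
        KeysCaseTwoLabels L v (μω.semilocalComponent L v) (torusLocalComponent L (IsCMField.complexConj L) v ξ.η)
          (torusLocalComponent L (IsCMField.complexConj L) v ξ.ψ) π2 πn → ¬ πn.IsSquareIntegrable (μZ v) →
        {πs : IrrClass ((cmDatum L 3 (qsForm L)).Local v) // πs.IsSupercuspidal ∧ πs ≠ IrrClass.comap (cmDatumLocalCongr L v T ha h).symm πn},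
      (∀ (ξ : OneDimAutRepH L) (v : HeightOneSpectrum (𝓞 ↥(maximalRealSubfield L))),
        (xiPacketFamilyOfRecordSCD L H hH hHd μω hμu μZ keys hSC ξ v).map (IrrClass.comap (ψ v).symm) =
          xiPacketFamilyOfRecordSCD L (qsForm L) hq hqd μω hμu μZ keys hSC₀ ξ v) ∧
      (∀ (ξ : OneDimAutRepH L) (v : HeightOneSpectrum (𝓞 ↥(maximalRealSubfield L)))
        (hns : ∀ w : PlacesOver L v, IsCMField.complexConj L • w.1 = w.1)
        (T : GL (Fin 3) (LocalRing L v)) (a : LocalRing L v) (ha : IsUnit a)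
        (h : formCongr (conjLocal L (IsCMField.complexConj L) v) T ((qsForm L).map (algebraMap L (LocalRing L v))) =
          a • (Matrix.of fun i j : Fin 3 => if i.val + j.val + 1 = 3 then (1 : L) else 0).map (algebraMap L (LocalRing L v)))
        (π2 πn : IrrClass (Gqs L v))
        (hK : KeysCaseTwoLabels L v (μω.semilocalComponent L v) (torusLocalComponent L (IsCMField.complexConj L) v ξ.η)
          (torusLocalComponent L (IsCMField.complexConj L) v ξ.ψ) π2 πn) (hn : ¬ πn.IsSquareIntegrable (μZ v)),
        ∃ (T₁ : GL (Fin 3) (LocalRing L v)) (a₁ : LocalRing L v) (ha₁ : IsUnit a₁)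
          (h₁ : formCongr (conjLocal L (IsCMField.complexConj L) v) T₁ (H.map (algebraMap L (LocalRing L v))) =
            a₁ • (Matrix.of fun i j : Fin 3 => if i.val + j.val + 1 = 3 then (1 : L) else 0).map (algebraMap L (LocalRing L v))),
          (hSC₀ ξ v hns T a ha h π2 πn hK hn).1 = IrrClass.comap (ψ v).symm (hSC ξ v hns T₁ a₁ ha₁ h₁ π2 πn hK hn).1) := by
  -- `ψ_v = Ad(T₂)` as a form congruence
  choose T₂ a₂ ha₂ h₂ hψ₂ using hψ
  have hψeq : ∀ v, ψ v = cmDatumLocalCongr L v (T₂ v) (ha₂ v) (h₂ v) := fun v => ContinuousMulEquiv.ext (hψ₂ v)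
  -- the H-record's congruence of choice `T₁` at the non-split places
  choose T₁ a₁ ha₁ h₁ hrec₁ _hlev using
    fun (ξ : OneDimAutRepH L) (v : HeightOneSpectrum (𝓞 ↥(maximalRealSubfield L)))
      (hns : ∀ w : PlacesOver L v, IsCMField.complexConj L • w.1 = w.1) =>
      F0P3XiPacketFamilyOfRecordSCD.xiPacketFamilyOfRecordSCD_of_nonsplit L H hH hHd μω hμu μZ keys hSC ξ v hns
  -- the same congruences with the target spelled `qsForm L` (reducibly the same matrix)
  have h₁' : ∀ (ξ : OneDimAutRepH L) (v : HeightOneSpectrum (𝓞 ↥(maximalRealSubfield L)))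
      (hns : ∀ w : PlacesOver L v, IsCMField.complexConj L • w.1 = w.1),
      formCongr (conjLocal L (IsCMField.complexConj L) v) (T₁ ξ v hns) (H.map (algebraMap L (LocalRing L v))) =
        a₁ ξ v hns • (qsForm L).map (algebraMap L (LocalRing L v)) := h₁
  -- the transported supercuspidal datum
  refine ⟨fun ξ v hns T a ha h π2 πn hK hn =>
    ⟨IrrClass.comap (ψ v).symm (hSC ξ v hns (T₁ ξ v hns) (a₁ ξ v hns) (ha₁ ξ v hns) (h₁ ξ v hns) π2 πn hK hn).1,
      (hSC ξ v hns (T₁ ξ v hns) (a₁ ξ v hns) (ha₁ ξ v hns) (h₁ ξ v hns) π2 πn hK hn).2.1.comap (ψ v).symm, fun heq => ?_⟩, ?_,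
    fun ξ v hns T a ha h π2 πn hK hn => ⟨T₁ ξ v hns, a₁ ξ v hns, ha₁ ξ v hns, h₁ ξ v hns, rfl⟩⟩
  · -- `πˢ_H ∘ ψ_v⁻¹ ≠ πⁿ ∘ Ad(T)⁻¹`: else `πˢ_H = πⁿ ∘ (Ad(T)⁻¹ ∘ Ad(T₂))`, an identification differing from `Ad(T₁)⁻¹` by a self-similitude of `Φ₃`
    apply (hSC ξ v hns (T₁ ξ v hns) (a₁ ξ v hns) (ha₁ ξ v hns) (h₁ ξ v hns) π2 πn hK hn).2.2
    have h' : formCongr (conjLocal L (IsCMField.complexConj L) v) T ((qsForm L).map (algebraMap L (LocalRing L v))) =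
        a • (qsForm L).map (algebraMap L (LocalRing L v)) := h
    rw [hψeq v] at heq
    have h1 := congrArg (IrrClass.comap (cmDatumLocalCongr L v (T₂ v) (ha₂ v) (h₂ v))) heq
    rw [IrrClass.comap_comap_symm, IrrClass.comap_comap] at h1
    rw [h1]
    refine (comap_eq_comap_of_conj_formCongr_qsForm _ _ (T⁻¹ * T₂ v * T₁ ξ v hns)
      ((((ha.unit⁻¹ : (LocalRing L v)ˣ).isUnit).mul (ha₂ v)).mul (ha₁ ξ v hns)) ?_ (fun g' => ?_) πn).symm
    · rw [formCongr_mul_eq, formCongr_mul_eq, formCongr_inv_eq_smul_of_formCongr_eq_smul T ha _ _ h', formCongr_smul_eq, h₂ v,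
        formCongr_smul_eq, formCongr_smul_eq, h₁' ξ v hns, smul_smul, smul_smul]
    · show T⁻¹ * (T₂ v * g'.val * (T₂ v)⁻¹) * T = T⁻¹ * T₂ v * T₁ ξ v hns * ((T₁ ξ v hns)⁻¹ * g'.val * T₁ ξ v hns) * (T⁻¹ * T₂ v * T₁ ξ v hns)⁻¹
      group
  · intro ξ v
    rcases Classical.em (∃ w : PlacesOver L v, IsCMField.complexConj L • w.1 ≠ w.1) with hs | hs
    · -- SPLIT: the split packet at the fixed witness rides `Ad(T₂)`
      rw [F0P3XiPacketFamilyOfRecordSCD.xiPacketFamilyOfRecordSCD_of_split L H hH hHd μω hμu μZ keys hSC ξ v hs,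
        F0P3XiPacketFamilyOfRecordSCD.xiPacketFamilyOfRecordSCD_of_split L (qsForm L) hq hqd μω hμu μZ keys _ ξ v hs, hψeq v]
      exact R90.S9.cmSplitPacket_map_comap_cmDatumLocalCongr_symm L hq hqd hH hHd v (T₂ v) (ha₂ v) (h₂ v)
        (splitWitness v hs) (splitWitness_spec v hs) _ _ _ _ _ _
    · -- NON-SPLIT: `⟨πⁿ ∘ Ad(T₂T₁)⁻¹, πˢ_H ∘ ψ_v⁻¹⟩ = ⟨πⁿ ∘ Ad(T₀)⁻¹, πˢ₀⟩`
      have hns : ∀ w : PlacesOver L v, IsCMField.complexConj L • w.1 = w.1 := fun w => not_not.1 fun hw => hs ⟨w, hw⟩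
      obtain ⟨T₀, a₀, ha₀, h₀, hrec₀, -⟩ :=
        F0P3XiPacketFamilyOfRecordSCD.xiPacketFamilyOfRecordSCD_of_nonsplit L (qsForm L) hq hqd μω hμu μZ keys _ ξ v hns
      have h₀' : formCongr (conjLocal L (IsCMField.complexConj L) v) T₀ ((qsForm L).map (algebraMap L (LocalRing L v))) =
          a₀ • (qsForm L).map (algebraMap L (LocalRing L v)) := h₀
      rw [hrec₁ ξ v hns, hrec₀]
      refine LocalAPacket.ext' ?_ rfl
      dsimp only [LocalAPacket.map]
      rw [hψeq v, IrrClass.comap_comap]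
      refine (comap_eq_comap_of_conj_formCongr_qsForm _ _ ((T₂ v * T₁ ξ v hns)⁻¹ * T₀)
        (((((ha₂ v).mul (ha₁ ξ v hns)).unit⁻¹ : (LocalRing L v)ˣ).isUnit).mul ha₀) ?_ (fun g' => ?_) _).symm
      · have h21 : formCongr (conjLocal L (IsCMField.complexConj L) v) (T₂ v * T₁ ξ v hns) ((qsForm L).map (algebraMap L (LocalRing L v))) =
            (a₂ v * a₁ ξ v hns) • (qsForm L).map (algebraMap L (LocalRing L v)) := by
          rw [formCongr_mul_eq, h₂ v, formCongr_smul_eq, h₁' ξ v hns, smul_smul]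
        rw [formCongr_mul_eq, formCongr_inv_eq_smul_of_formCongr_eq_smul _ ((ha₂ v).mul (ha₁ ξ v hns)) _ _ h21, formCongr_smul_eq, h₀',
          smul_smul]
      · show (T₁ ξ v hns)⁻¹ * ((T₂ v)⁻¹ * g'.val * T₂ v) * T₁ ξ v hns =
          (T₂ v * T₁ ξ v hns)⁻¹ * T₀ * (T₀⁻¹ * g'.val * T₀) * ((T₂ v * T₁ ξ v hns)⁻¹ * T₀)⁻¹
        group

end Transport

/-! ## §4 The SIGNED [13.1.4] on test functions rides with the datum -/

section SignedTransport

variable (L : Type) [Field L] [NumberField L] [IsCMField L] (H : Matrix (Fin 3) (Fin 3) L)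
  (v : HeightOneSpectrum (𝓞 ↥(maximalRealSubfield L)))

open scoped Classical in
set_option synthInstance.maxHeartbeats 400000 in
set_option maxHeartbeats 4000000 in
/-- **THE SIGNED [13.1.4] FOR THE TRANSPORTED DATUM, AT EVERY Φ₃-SELF-FRAME.**  At a non-split `v`, for `H` hermitian with unit determinant, an H-frame `ᵗS̄ · H_v · S = m · Φ₃`
(`e_S := cmDatumLocalCongr L v S hm h' : U(Φ₃)_v ≃ₜ* U(H)_v`, the kit's `ψ_v⁻¹`), a second H-frame `(T₁, a₁)` and a Φ₃-self-frame `ᵗT̄″ · Φ₃ · T″ = a″ · Φ₃`: if the packet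
`⟨πⁿ ∘ e_{T₁}⁻¹, πˢ⟩` of `U(H)_v` satisfies the SIGNED character identity on test functions at `D = (Δ‴_H, m_H, m_G, ν_G, ν_H, ξ_v)` with the clause sign `χ(a₁) = [a₁ ∈ z σz]`, then
`⟨πⁿ ∘ e_{T″}⁻¹, πˢ ∘ e_S⟩` satisfies it on `U(Φ₃)_v` at `D₀ = (Δ‴_{Φ₃}, m_H, e_S⁻¹_* m_G, e_S⁻¹_* ν_G, ν_H, ξ_v)` with the clause sign `χ(a″)`.  PROOF: ★ S9
`charIdentityAtTestSigned_pair_transport_formCongr` along `(S, m)` gives the identity for `⟨(πⁿ ∘ e_{T₁}⁻¹) ∘ e_S, πˢ ∘ e_S⟩` with sign `χ(m)·χ(a₁)`; the identifications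
`e_{T₁}⁻¹ ∘ e_S` and `e_{T″}⁻¹` of `U(Φ₃)_v` with itself differ by the self-similitude `T₁⁻¹ S T″`, which is inner (§1); and `χ(m) = χ(a₁) = ε_v(H)` (★
`clauseSign_eq_intCast_formSignAt`), `ε_v(H)² = 1`, `χ(a″) = 1` (★ `clauseSign_antidiag_frame_eq_one`).
[cite: Rogawski1990, §13.1 Prop. 13.1.4 p. 199; §14.2 pp. 232–234; §14.6 p. 242] [cite: LanglandsShelstad1987, §1, §4.2] [cite: BushnellHenniart2006, §1.1] -/
theorem charIdentityAtTest_transport_of_frames (μ : HeckeCharacter L)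
    (hns : ∀ w : PlacesOver L v, IsCMField.complexConj L • w.1 = w.1)
    (hH : (H.map (cmConjRingHom L))ᵀ = H) (hHd : IsUnit H.det)
    (S : GL (Fin 3) (LocalRing L v)) {m : LocalRing L v} (hm : IsUnit m)
    (h' : formCongr (conjLocal L (IsCMField.complexConj L) v) S (H.map (algebraMap L (LocalRing L v))) =
      m • (Matrix.of fun i j : Fin 3 => if i.val + j.val + 1 = 3 then (1 : L) else 0).map (algebraMap L (LocalRing L v)))
    [MeasurableSpace ((cmDatum L 3 H).Local v)] [BorelSpace ((cmDatum L 3 H).Local v)]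
    [MeasurableSpace ((cmDatum L 3 (Matrix.of fun i j : Fin 3 => if i.val + j.val + 1 = 3 then (1 : L) else 0)).Local v)]
    [BorelSpace ((cmDatum L 3 (Matrix.of fun i j : Fin 3 => if i.val + j.val + 1 = 3 then (1 : L) else 0)).Local v)]
    [∀ γ : (cmDatum L 3 H).Local v, MeasurableSpace (((cmDatum L 3 H).Local v) ⧸ Subgroup.centralizer ({γ} : Set ((cmDatum L 3 H).Local v)))]
    [∀ γ : (cmDatum L 3 H).Local v, BorelSpace (((cmDatum L 3 H).Local v) ⧸ Subgroup.centralizer ({γ} : Set ((cmDatum L 3 H).Local v)))]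
    [∀ γ : (cmDatum L 3 (Matrix.of fun i j : Fin 3 => if i.val + j.val + 1 = 3 then (1 : L) else 0)).Local v,
      MeasurableSpace (((cmDatum L 3 (Matrix.of fun i j : Fin 3 => if i.val + j.val + 1 = 3 then (1 : L) else 0)).Local v) ⧸
        Subgroup.centralizer ({γ} : Set ((cmDatum L 3 (Matrix.of fun i j : Fin 3 => if i.val + j.val + 1 = 3 then (1 : L) else 0)).Local v)))]
    [∀ γ : (cmDatum L 3 (Matrix.of fun i j : Fin 3 => if i.val + j.val + 1 = 3 then (1 : L) else 0)).Local v,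
      BorelSpace (((cmDatum L 3 (Matrix.of fun i j : Fin 3 => if i.val + j.val + 1 = 3 then (1 : L) else 0)).Local v) ⧸
        Subgroup.centralizer ({γ} : Set ((cmDatum L 3 (Matrix.of fun i j : Fin 3 => if i.val + j.val + 1 = 3 then (1 : L) else 0)).Local v)))]
    [MeasurableSpace ((cmDatum L 2 (Matrix.of fun i j : Fin 2 => if i.val + j.val + 1 = 2 then (1 : L) else 0)).Local v ×
      (cmDatum L 1 (Matrix.of fun i j : Fin 1 => if i.val + j.val + 1 = 1 then (1 : L) else 0)).Local v)]
    [∀ a' : (cmDatum L 2 (Matrix.of fun i j : Fin 2 => if i.val + j.val + 1 = 2 then (1 : L) else 0)).Local v ×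
        (cmDatum L 1 (Matrix.of fun i j : Fin 1 => if i.val + j.val + 1 = 1 then (1 : L) else 0)).Local v,
      MeasurableSpace (((cmDatum L 2 (Matrix.of fun i j : Fin 2 => if i.val + j.val + 1 = 2 then (1 : L) else 0)).Local v ×
          (cmDatum L 1 (Matrix.of fun i j : Fin 1 => if i.val + j.val + 1 = 1 then (1 : L) else 0)).Local v) ⧸
        Subgroup.centralizer ({a'} : Set ((cmDatum L 2 (Matrix.of fun i j : Fin 2 => if i.val + j.val + 1 = 2 then (1 : L) else 0)).Local v ×
          (cmDatum L 1 (Matrix.of fun i j : Fin 1 => if i.val + j.val + 1 = 1 then (1 : L) else 0)).Local v)))]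
    (mHv : OrbitalMeasureFamily ((cmDatum L 2 (Matrix.of fun i j : Fin 2 => if i.val + j.val + 1 = 2 then (1 : L) else 0)).Local v ×
      (cmDatum L 1 (Matrix.of fun i j : Fin 1 => if i.val + j.val + 1 = 1 then (1 : L) else 0)).Local v))
    (mGv : OrbitalMeasureFamily ((cmDatum L 3 H).Local v))
    (νG : Measure ((cmDatum L 3 H).Local v)) [νG.IsHaarMeasure]
    (νH : Measure ((cmDatum L 2 (Matrix.of fun i j : Fin 2 => if i.val + j.val + 1 = 2 then (1 : L) else 0)).Local v ×
      (cmDatum L 1 (Matrix.of fun i j : Fin 1 => if i.val + j.val + 1 = 1 then (1 : L) else 0)).Local v))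
    (ξv : (cmDatum L 2 (Matrix.of fun i j : Fin 2 => if i.val + j.val + 1 = 2 then (1 : L) else 0)).Local v ×
      (cmDatum L 1 (Matrix.of fun i j : Fin 1 => if i.val + j.val + 1 = 1 then (1 : L) else 0)).Local v →* ℂˣ)
    (T₁ : GL (Fin 3) (LocalRing L v)) (a₁ : LocalRing L v) (ha₁ : IsUnit a₁)
    (h₁ : formCongr (conjLocal L (IsCMField.complexConj L) v) T₁ (H.map (algebraMap L (LocalRing L v))) =
      a₁ • (Matrix.of fun i j : Fin 3 => if i.val + j.val + 1 = 3 then (1 : L) else 0).map (algebraMap L (LocalRing L v)))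
    (T'' : GL (Fin 3) (LocalRing L v)) (a'' : LocalRing L v) (ha'' : IsUnit a'')
    (h'' : formCongr (conjLocal L (IsCMField.complexConj L) v) T'' ((qsForm L).map (algebraMap L (LocalRing L v))) =
      a'' • (Matrix.of fun i j : Fin 3 => if i.val + j.val + 1 = 3 then (1 : L) else 0).map (algebraMap L (LocalRing L v)))
    (πn : IrrClass (Gqs L v)) (πs : IrrClass ((cmDatum L 3 H).Local v))
    (hid : (⟨IrrClass.comap (cmDatumLocalCongr L v T₁ ha₁ h₁).symm πn, some πs⟩ : CMLocalAPacket L H v).CharIdentityAtTest L H v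
      (fun c f => (if ∃ z : LocalRing L v, IsUnit z ∧ a₁ = z * conjLocal L (IsCMField.complexConj L) v z then (1 : ℂ) else -1) * c.smoothTrace νG f)
      ξv νH ((finExplicitCollection L H μ (finExplicitDelta_conj_left_all L H μ) (finExplicitDelta_conj_right_all L H μ)) v) mHv mGv) :
    (⟨IrrClass.comap (cmDatumLocalCongr L v T'' ha'' h'').symm πn, some (IrrClass.comap (cmDatumLocalCongr L v S hm h') πs)⟩ :
        CMLocalAPacket L (qsForm L) v).CharIdentityAtTest L (qsForm L) v
      (fun c f => (if ∃ z : LocalRing L v, IsUnit z ∧ a'' = z * conjLocal L (IsCMField.complexConj L) v z then (1 : ℂ) else -1) *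
        c.smoothTrace (νG.map (cmDatumLocalCongr L v S hm h').symm) f)
      ξv νH
      ((finExplicitCollection L (qsForm L) μ (finExplicitDelta_conj_left_all L (qsForm L) μ) (finExplicitDelta_conj_right_all L (qsForm L) μ)) v) mHv
      (mGv.transport (cmDatumLocalCongr L v S hm h').symm.toMulEquiv (cmDatumLocalCongr L v S hm h').symm.continuous
        (cmDatumLocalCongr L v S hm h').continuous) := by
  obtain ⟨w⟩ := (inferInstance : Nonempty (PlacesOver L v))
  have hσm : conjLocal L (IsCMField.complexConj L) v m = m := conjLocal_eq_self_of_formCongr_eq_smul_antidiag L (by norm_num) hH v S h'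
  -- ride the H-frame `(S, m)`: identity for `⟨(πⁿ ∘ e_{T₁}⁻¹) ∘ e_S, πˢ ∘ e_S⟩` with sign `χ(m)·χ(a₁)`
  have hT := R90.S9.charIdentityAtTestSigned_pair_transport_formCongr L H v μ w (hns w) hH hHd S hm hσm h' mHv mGv νG νH ξv
    (if ∃ z : LocalRing L v, IsUnit z ∧ a₁ = z * conjLocal L (IsCMField.complexConj L) v z then (1 : ℂ) else -1)
    (IrrClass.comap (cmDatumLocalCongr L v T₁ ha₁ h₁).symm πn) πs hid
  -- spellings with `qsForm L` (reducibly the same matrix) for the §1 rewrites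
  have h'q : formCongr (conjLocal L (IsCMField.complexConj L) v) S (H.map (algebraMap L (LocalRing L v))) =
      m • (qsForm L).map (algebraMap L (LocalRing L v)) := h'
  have h₁q : formCongr (conjLocal L (IsCMField.complexConj L) v) T₁ (H.map (algebraMap L (LocalRing L v))) =
      a₁ • (qsForm L).map (algebraMap L (LocalRing L v)) := h₁
  have h''q : formCongr (conjLocal L (IsCMField.complexConj L) v) T'' ((qsForm L).map (algebraMap L (LocalRing L v))) =
      a'' • (qsForm L).map (algebraMap L (LocalRing L v)) := h''
  -- CLASS LAW: `(πⁿ ∘ e_{T₁}⁻¹) ∘ e_S = πⁿ ∘ e_{T″}⁻¹` — the two identifications differ by the self-similitude `T₁⁻¹ S T″` of `Φ₃`, which is inner (§1)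
  have hcl : IrrClass.comap (cmDatumLocalCongr L v S hm h') (IrrClass.comap (cmDatumLocalCongr L v T₁ ha₁ h₁).symm πn) =
      IrrClass.comap (cmDatumLocalCongr L v T'' ha'' h'').symm πn := by
    rw [IrrClass.comap_comap]
    refine (comap_eq_comap_of_conj_formCongr_qsForm _ _ ((T₁)⁻¹ * S * T'')
      ((((ha₁.unit⁻¹ : (LocalRing L v)ˣ).isUnit).mul hm).mul ha'') ?_ (fun g' => ?_) πn).symm
    · rw [formCongr_mul_eq, formCongr_mul_eq, formCongr_inv_eq_smul_of_formCongr_eq_smul T₁ ha₁ _ _ h₁q, formCongr_smul_eq, h'q,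
        formCongr_smul_eq, formCongr_smul_eq, h''q, smul_smul, smul_smul]
    · show (T₁)⁻¹ * (S * g'.val * S⁻¹) * T₁ = (T₁)⁻¹ * S * T'' * ((T'')⁻¹ * g'.val * T'') * ((T₁)⁻¹ * S * T'')⁻¹
      group
  -- SIGN LAW: `χ(m)·χ(a₁) = ε_v(H)² = 1 = χ(a″)`
  have hsg : (((if ∃ z : LocalRing L v, IsUnit z ∧ m = z * conjLocal L (IsCMField.complexConj L) v z then (1 : ℤ) else -1 : ℤ) : ℂ)) *
      (if ∃ z : LocalRing L v, IsUnit z ∧ a₁ = z * conjLocal L (IsCMField.complexConj L) v z then (1 : ℂ) else -1) =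
      (if ∃ z : LocalRing L v, IsUnit z ∧ a'' = z * conjLocal L (IsCMField.complexConj L) v z then (1 : ℂ) else -1) := by
    have hcast : (((if ∃ z : LocalRing L v, IsUnit z ∧ m = z * conjLocal L (IsCMField.complexConj L) v z then (1 : ℤ) else -1 : ℤ) : ℂ)) =
        (if ∃ z : LocalRing L v, IsUnit z ∧ m = z * conjLocal L (IsCMField.complexConj L) v z then (1 : ℂ) else -1) := by
      split_ifs <;> simp
    rw [hcast, clauseSign_eq_intCast_formSignAt L H hH v hns S m hm h', clauseSign_eq_intCast_formSignAt L H hH v hns T₁ a₁ ha₁ h₁,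
      intCast_formSignAt_mul_self, R90.S9.clauseSign_antidiag_frame_eq_one L v hns T'' a'' ha'' h'']
  rw [hcl] at hT
  simp only [hsg] at hT
  exact hT


end SignedTransport

end Summit.HodgeConjecture.HodgeConjecture.R90.S7

end
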